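import Literature.Computability.Cryptography.WordRAMInline1
import Literature.Computability.Cryptography.WordRAMCode
import Literature.Computability.Cryptography.WordRAMPigeonhole
import HarnessLib

/-!
# The word RAM — a universal program, I: the interpreter round

A *universal* word-RAM program: straight-line code `Univ.STEP` which, run at a large word size
`W`, performs one clamped step (`WordRAM.stepTotal`) of an arbitrary deterministic oracle-free
program given as *data* — its code words (`Literature.Computability.Cryptography.WordRAMCode`)
stored in memory from cell `44` on — on a simulated `w₀`-bit memory held in the cells from
`B = 2 ^ (W - 1)` on. The round is branch-free: it fetches the eight fields of the current
instruction, evaluates both operands for all three addressing modes and all twelve operations,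
and selects results, write target, new program counter and halting flag arithmetically by
`0/1` masks, so that its semantics is a single straight-line computation (`Univ.round_spec`).
This file is the technical core of the refutation of the vendored transfer property
`FGReducible.trulySubTime` (`Literature.Computability.Cryptography.FGComplexity`); part II
(`WordRAMUniversal2`) wraps the round in a fuel-counting loop with prologue and epilogue.

Register map (cells `< 40`; cells `41 …` hold the input `q`, code fields of instruction `i` at
`44 + 8 i + f`): `8 = B` (base of the simulated memory), `9 = P₀ = 2 ^ w₀`, `10 =` fuel,
`11 = PC`, `12 = H` (halted flag), `39 =` junk write target, `42 = |P|`; temporaries `13 … 38`.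

This is the classical interpreter of a stored-program RAM (Cook–Reckhow, *Time bounded random
access machines*, JCSS 7 (1973), §2 — RAM programs held in registers and interpreted with
constant-factor overhead), written out for the instruction set of `WordRAM.Instr`.

## References

* S. A. Cook, R. A. Reckhow, *Time bounded random access machines*, J. Comput. Syst. Sci. 7
  (1973), 354–375, §2.
-/

namespace Literature.Computability.Cryptography.WordRAM

open StateTransition

/-! ## Frames of straight-line register code -/

/-- The registers written by a list of operations whose destinations are direct. [folklore] -/
def dests (ops : List OpSpec) : List ℕ :=
  ops.filterMap fun s => match s.2.1 with
    | .dir r => some r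
    | _ => none

/-- `allDir ops`: every operation writes a direct register (no `imm`/`ind` destination). [folklore] -/
def allDir (ops : List OpSpec) : Bool :=
  ops.all fun s => match s.2.1 with
    | .dir _ => true
    | _ => false

/-- **Frame rule.** Register code writing only direct registers leaves every cell outside its
destination list unchanged. [folklore] -/
theorem execOps_apply_of_not_mem_dests {W : ℕ} :
    ∀ (ops : List OpSpec) (mem : ℕ → ℕ) {a : ℕ}, allDir ops = true → a ∉ dests ops →
      execOps W mem ops a = mem a
  | [], mem, a, _, _ => rfl
  | ⟨o, d, x, y⟩ :: ops, mem, a, hd, ha => by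
    cases d with
    | imm c => simp [allDir] at hd
    | ind r => simp [allDir] at hd
    | dir r =>
      have hd' : allDir ops = true := by simpa [allDir] using hd
      have ha' : a ≠ r ∧ a ∉ dests ops := by simpa [dests] using ha
      rw [execOps_cons, execOps_apply_of_not_mem_dests ops _ hd' ha'.2, execOp_dir,
        Function.update_of_ne ha'.1]

namespace Univ

/-! ## Block S1: control flags

`13 := 1 - H` (active), `14 := [PC < |P|]` (in range), `15 := go = active · inRange`,
`16 := active - go` (active but out of range: the simulated machine halts now), `H += 16`. -/

/-- Block S1 (control flags). [folklore] -/
def S1 : List OpSpec :=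
  [(.sub, .dir 13, .imm 1, .dir 12), (.lt, .dir 14, .dir 11, .dir 42), (.mul, .dir 15, .dir 13, .dir 14),
   (.sub, .dir 16, .dir 13, .dir 15), (.add, .dir 12, .dir 12, .dir 16)]

/-- Semantics of S1: with `H ≤ 1`, the flags are `go = (1 - H) · [PC < |P|]`,
`hl = (1 - H) · (1 - [PC < |P|])`, and `H` becomes `H + hl`. [folklore] -/
theorem execOps_S1 {W : ℕ} (hW : 2 ≤ W) (m : ℕ → ℕ) (hH : m 12 ≤ 1) :
    let inR : ℕ := if m 11 < m 42 then 1 else 0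
    (execOps W m S1) 15 = (1 - m 12) * inR ∧
    (execOps W m S1) 16 = (1 - m 12) * (1 - inR) ∧
    (execOps W m S1) 12 = m 12 + (1 - m 12) * (1 - inR) ∧
    ∀ a, a ∉ dests S1 → (execOps W m S1) a = m a := by
  intro inR
  have h4 : 4 ≤ 2 ^ W := by
    have := Nat.pow_le_pow_right (show 0 < 2 by norm_num) hW; simpa using this
  refine ⟨?_, ?_, ?_, fun a ha => execOps_apply_of_not_mem_dests S1 m rfl ha⟩
  all_goals
    simp only [S1, execOps_cons, execOps_nil, execOp_dir, Operand.read_dir, Operand.read_imm,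
      BinOp.eval]
    simp (config := { decide := true }) only [Function.update_self, Function.update_of_ne, ne_eq]
  · rw [sub_eval_of_le hH (by omega), Nat.mod_eq_of_lt (by split_ifs <;> omega)]
  · rw [sub_eval_of_le hH (by omega)]
    have hp : (1 - m 12) * (if m 11 < m 42 then 1 else 0) ≤ 1 - m 12 := by split_ifs <;> omega
    rw [Nat.mod_eq_of_lt (a := (1 - m 12) * _) (by split_ifs <;> omega), sub_eval_of_le hp (by omega)]
    simp only [inR]; split_ifs <;> omega
  · rw [sub_eval_of_le hH (by omega)]
    have hp : (1 - m 12) * (if m 11 < m 42 then 1 else 0) ≤ 1 - m 12 := by split_ifs <;> omega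
    rw [Nat.mod_eq_of_lt (a := (1 - m 12) * _) (by split_ifs <;> omega), sub_eval_of_le hp (by omega),
      Nat.mod_eq_of_lt (by split_ifs <;> omega)]
    simp only [inR]; split_ifs <;> omega

/-! ## Block S2: fetch the eight fields of the current instruction

`17 := 44 + 8 · PC`, then field `f` (cell `17 + f` of the code area) is copied to register
`18 + f`: `18 = opc, 19 = dκ, 20 = dv, 21 = xκ, 22 = xv, 23 = yκ, 24 = yv, 25 = t`. -/

/-- Fetch field `f`: `26 := R17 + f; R(18+f) := mem[R26]`. [folklore] -/
def fetch (f : ℕ) : List OpSpec :=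
  [(.add, .dir 26, .dir 17, .imm f), (.div, .dir (18 + f), .ind 26, .imm 1)]

/-- Semantics of one fetch: with `R17 = A ≥ 40`, `A + f < 2 ^ W`, `f < 8`, register `18 + f`
receives cell `A + f`, register `26` becomes `A + f`, nothing else changes. [folklore] -/
theorem execOps_fetch {W : ℕ} (m : ℕ → ℕ) {A f : ℕ} (h17 : m 17 = A) (hA : 40 ≤ A)
    (hAf : A + f < 2 ^ W) (hf : f < 8) :
    (execOps W m (fetch f)) (18 + f) = m (A + f) ∧ (execOps W m (fetch f)) 26 = A + f ∧
    ∀ a, a ≠ 26 → a ≠ 18 + f → (execOps W m (fetch f)) a = m a := by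
  have h1 : A + f ≠ 26 := by omega
  have h2 : (26 : ℕ) ≠ 18 + f := by omega
  simp only [fetch, execOps_cons, execOps_nil, execOp_dir, Operand.read_dir, Operand.read_ind,
    Operand.read_imm, BinOp.eval, Nat.div_one, h17, Nat.mod_eq_of_lt hAf]
  refine ⟨?_, ?_, fun a ha hb => ?_⟩
  · rw [Function.update_self, Function.update_self, Function.update_of_ne h1]
  · rw [Function.update_of_ne h2, Function.update_self]
  · rw [Function.update_of_ne hb, Function.update_of_ne ha]

/-- The set-up of the fetch: `17 := 44 + 8 · PC`. [folklore] -/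
def S2pre : List OpSpec :=
  [(.mul, .dir 17, .dir 11, .imm 8), (.add, .dir 17, .dir 17, .imm 44)]

/-- The first `n` fetches. [folklore] -/
def fetches : ℕ → List OpSpec
  | 0 => []
  | n + 1 => fetches n ++ fetch n

/-- Block S2 (instruction fetch). [folklore] -/
def S2 : List OpSpec := S2pre ++ fetches 8

/-- Semantics of the fetch set-up. [folklore] -/
theorem execOps_S2pre {W : ℕ} (m : ℕ → ℕ) {p : ℕ} (h11 : m 11 = p) (hp : 8 * p + 51 < 2 ^ W) :
    (execOps W m S2pre) 17 = 44 + 8 * p ∧ ∀ a, a ≠ 17 → (execOps W m S2pre) a = m a := by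
  simp only [S2pre, execOps_cons, execOps_nil, execOp_dir, Operand.read_dir, Operand.read_imm,
    BinOp.eval, h11]
  refine ⟨?_, fun a ha => ?_⟩
  · rw [Function.update_self, Function.update_self, Nat.mod_eq_of_lt (a := p * 8) (by omega),
      Nat.mod_eq_of_lt (by omega)]
    omega
  · rw [Function.update_of_ne ha, Function.update_of_ne ha]

/-- Semantics of the first `n` fetches from `R17 = A ≥ 40`. [folklore] -/
theorem execOps_fetches {W : ℕ} (m : ℕ → ℕ) {A : ℕ} (h17 : m 17 = A) (hA : 40 ≤ A)
    (hA7 : A + 7 < 2 ^ W) : ∀ n, n ≤ 8 →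
    (∀ f, f < n → (execOps W m (fetches n)) (18 + f) = m (A + f)) ∧
    (execOps W m (fetches n)) 17 = A ∧
    ∀ a, (a < 17 ∨ 26 < a) → (execOps W m (fetches n)) a = m a
  | 0, _ => ⟨fun f hf => absurd hf (Nat.not_lt_zero _), h17, fun a _ => rfl⟩
  | n + 1, hn => by
    obtain ⟨ih1, ih2, ih3⟩ := execOps_fetches m h17 hA hA7 n (by omega)
    rw [fetches, execOps_append]
    obtain ⟨e1, -, e3⟩ := execOps_fetch (W := W) (execOps W m (fetches n)) ih2 hA (by omega)
      (show n < 8 by omega)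
    refine ⟨fun f hf => ?_, ?_, fun a ha => ?_⟩
    · rcases Nat.lt_succ_iff_lt_or_eq.1 hf with hf' | rfl
      · rw [e3 _ (by omega) (by omega), ih1 f hf']
      · rw [e1, ih3 _ (by omega)]
    · rw [e3 _ (by omega) (by omega), ih2]
    · rw [e3 _ (by omega) (by omega), ih3 a ha]

/-- **Semantics of S2.** With `PC = p` and the code area addressable, registers `18 + f`
(`f < 8`) receive the fields `mem (44 + 8 p + f)`; cells below `17` and above `26` are
unchanged. [folklore] -/
theorem execOps_S2 {W : ℕ} (m : ℕ → ℕ) {p : ℕ} (h11 : m 11 = p) (hp : 8 * p + 51 < 2 ^ W) :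
    (∀ f, f < 8 → (execOps W m S2) (18 + f) = m (44 + 8 * p + f)) ∧
    ∀ a, (a < 17 ∨ 26 < a) → (execOps W m S2) a = m a := by
  obtain ⟨a17, af⟩ := execOps_S2pre (W := W) m h11 hp
  obtain ⟨b1, -, b3⟩ := execOps_fetches (W := W) (execOps W m S2pre) a17 (by omega) (by omega) 8 le_rfl
  rw [S2, execOps_append]
  refine ⟨fun f hf => ?_, fun a ha => ?_⟩
  · rw [b1 f hf, af _ (by omega)]
  · rw [b3 a ha, af _ (by omega)]

/-! ## Operand evaluation

For an operand with mode word in register `κr` and value word in register `vr` (both among the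
field registers `18 … 25`), `opnd κr vr out` computes its value in the simulated memory
(cells `B + a`) into register `out`, using `27 … 31` as temporaries:
`27 := mem[B + v]`, `28 := mem[B + mem[B + v]]`, masks `29, 30, 31 := [κ = 0], [κ = 1], [1 < κ]`,
`out := [κ = 0] · v + [κ = 1] · R27 + [1 < κ] · R28`. -/

/-- The two memory probes of operand evaluation. [folklore] -/
def opndA (vr : ℕ) : List OpSpec :=
  [(.add, .dir 27, .dir 8, .dir vr), (.div, .dir 27, .ind 27, .imm 1),
   (.add, .dir 28, .dir 8, .dir 27), (.div, .dir 28, .ind 28, .imm 1)]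

/-- The mask-and-combine part of operand evaluation. [folklore] -/
def opndB (κr vr out : ℕ) : List OpSpec :=
  [(.eq, .dir 29, .dir κr, .imm 0), (.eq, .dir 30, .dir κr, .imm 1), (.lt, .dir 31, .imm 1, .dir κr),
   (.mul, .dir 29, .dir 29, .dir vr), (.mul, .dir 30, .dir 30, .dir 27), (.mul, .dir 31, .dir 31, .dir 28),
   (.add, .dir 29, .dir 29, .dir 30), (.add, .dir out, .dir 29, .dir 31)]

/-- Operand evaluation. [folklore] -/
def opnd (κr vr out : ℕ) : List OpSpec := opndA vr ++ opndB κr vr out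

/-- Semantics of the probes: `27 := mem (B + v)`, `28 := mem (B + mem (B + v))` when these
addresses are words (and `B ≥ 40`). [folklore] -/
theorem execOps_opndA {W : ℕ} (m : ℕ → ℕ) {vr : ℕ} (hvr : vr < 27 ∨ 31 < vr) (hB : 40 ≤ m 8)
    (h1 : m 8 + m vr < 2 ^ W) (h2 : m 8 + m (m 8 + m vr) < 2 ^ W) :
    (execOps W m (opndA vr)) 27 = m (m 8 + m vr) ∧
    (execOps W m (opndA vr)) 28 = m (m 8 + m (m 8 + m vr)) ∧
    ∀ a, a ≠ 27 → a ≠ 28 → (execOps W m (opndA vr)) a = m a := by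
  have n1 : m 8 + m vr ≠ 27 := by omega
  have n2 : m 8 + m (m 8 + m vr) ≠ 27 := by omega
  have n3 : m 8 + m (m 8 + m vr) ≠ 28 := by omega
  have hv27 : vr ≠ 27 := by omega
  have h8 : (8 : ℕ) ≠ 27 := by decide
  simp only [opndA, execOps_cons, execOps_nil, execOp_dir, Operand.read_dir, Operand.read_ind,
    Operand.read_imm, BinOp.eval, Nat.div_one]
  simp (config := { decide := true }) only [Function.update_self, Function.update_of_ne, ne_eq,
    Nat.mod_eq_of_lt h1, n1, Nat.mod_eq_of_lt h2, n2, n3, not_false_eq_true]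
  refine ⟨trivial, trivial, fun a ha hb => ?_⟩
  simp (config := { decide := true }) only [Function.update_of_ne, ne_eq, ha, hb, not_false_eq_true]

/-- Semantics of mask-and-combine: with `27 = m₁`, `28 = m₂`, mode `κ` and value `v` words,
`out := if κ = 0 then v else if κ = 1 then m₁ else m₂`. [folklore] -/
theorem execOps_opndB {W : ℕ} (m : ℕ → ℕ) {κr vr out : ℕ} (hκr : κr < 27 ∨ 33 < κr)
    (hvr : vr < 27 ∨ 33 < vr) (hout : out = 32 ∨ out = 33) (hv : m vr < 2 ^ W) (h27 : m 27 < 2 ^ W)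
    (h28 : m 28 < 2 ^ W) :
    (execOps W m (opndB κr vr out)) out =
      (if m κr = 0 then m vr else if m κr = 1 then m 27 else m 28) ∧
    ∀ a, a ≠ 29 → a ≠ 30 → a ≠ 31 → a ≠ out → (execOps W m (opndB κr vr out)) a = m a := by
  have k29 : κr ≠ 29 := by omega
  have k30 : κr ≠ 30 := by omega
  have k31 : κr ≠ 31 := by omega
  have v29 : vr ≠ 29 := by omega
  have v30 : vr ≠ 30 := by omega
  have v31 : vr ≠ 31 := by omega
  have o29 : (29 : ℕ) ≠ out := by omega
  have o30 : (30 : ℕ) ≠ out := by omega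
  have o31 : (31 : ℕ) ≠ out := by omega
  have o27 : (27 : ℕ) ≠ out := by omega
  have o28 : (28 : ℕ) ≠ out := by omega
  simp only [opndB, execOps_cons, execOps_nil, execOp_dir, Operand.read_dir, Operand.read_imm,
    BinOp.eval]
  simp (config := { decide := true }) only [Function.update_self, Function.update_of_ne, ne_eq, k29,
    k30, v29, v30, v31, not_false_eq_true]
  refine ⟨?_, fun a h29 h30 h31 ho => ?_⟩
  · by_cases e0 : m κr = 0
    · simp [e0, Nat.mod_eq_of_lt hv]
    by_cases e1 : m κr = 1
    · simp [e1, Nat.mod_eq_of_lt h27]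
    have e2 : 1 < m κr := by omega
    simp [e0, e1, e2, Nat.mod_eq_of_lt h28]
  · simp (config := { decide := true }) only [Function.update_of_ne, ne_eq, h29, h30, h31, ho,
      not_false_eq_true]

/-- **Semantics of operand evaluation.** With `B = m 8 ≥ 40` and the probed addresses words,
`out` receives the value of the operand with mode word `m κr` and value word `m vr` read in the
simulated memory `a ↦ m (B + a)`; only `27 … 31` and `out` change. [folklore] -/
theorem execOps_opnd {W : ℕ} (m : ℕ → ℕ) {κr vr out : ℕ} (hκr : κr < 27 ∨ 33 < κr)
    (hvr : vr < 27 ∨ 33 < vr) (hout : out = 32 ∨ out = 33) (hw : ∀ a, m a < 2 ^ W) (hB : 40 ≤ m 8)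
    (h1 : m 8 + m vr < 2 ^ W) (h2 : m 8 + m (m 8 + m vr) < 2 ^ W) :
    (execOps W m (opnd κr vr out)) out =
      (Operand.decode (m κr) (m vr)).read (fun a => m (m 8 + a)) ∧
    ∀ a, a ∉ dests (opnd κr vr out) → (execOps W m (opnd κr vr out)) a = m a := by
  obtain ⟨a27, a28, af⟩ := execOps_opndA (W := W) m (vr := vr) (by omega) hB h1 h2
  have hκ' : (execOps W m (opndA vr)) κr = m κr := af _ (by omega) (by omega)
  have hv' : (execOps W m (opndA vr)) vr = m vr := af _ (by omega) (by omega)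
  obtain ⟨b1, -⟩ := execOps_opndB (W := W) (execOps W m (opndA vr)) hκr hvr hout
    (by rw [hv']; exact hw _) (by rw [a27]; exact hw _) (by rw [a28]; exact hw _)
  refine ⟨?_, fun a ha => execOps_apply_of_not_mem_dests _ m rfl ha⟩
  rw [opnd, execOps_append, b1, hκ', hv', a27, a28, Operand.read_decode]


/-- Frame of operand evaluation (unconditional). [folklore] -/
theorem execOps_opnd_frame {W : ℕ} (m : ℕ → ℕ) (κr vr out : ℕ) :
    ∀ a, a ∉ dests (opnd κr vr out) → (execOps W m (opnd κr vr out)) a = m a :=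
  fun _ ha => execOps_apply_of_not_mem_dests _ m rfl ha

/-! ## Block S5: the write target of the destination operand

With destination mode `dκ = R19` and value `dv = R20`: `35 := dm = [dκ ≠ 0]` (a real write) and
`34 := dd = B + (dv if dκ = 1, else mem[B + dv])` (the target cell, meaningful when `dm = 1`). -/

/-- Block S5 (destination address). [folklore] -/
def S5 : List OpSpec :=
  [(.add, .dir 27, .dir 8, .dir 20), (.div, .dir 28, .ind 27, .imm 1), (.add, .dir 28, .dir 8, .dir 28),
   (.eq, .dir 30, .dir 19, .imm 1), (.lt, .dir 31, .imm 1, .dir 19),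
   (.mul, .dir 27, .dir 27, .dir 30), (.mul, .dir 28, .dir 28, .dir 31),
   (.add, .dir 34, .dir 27, .dir 28), (.add, .dir 35, .dir 30, .dir 31)]

/-- Semantics of S5, unconditional part: `R35 = [dκ ≠ 0] ≤ 1`, and only `27, 28, 30, 31, 34, 35`
change. [folklore] -/
theorem execOps_S5_mask {W : ℕ} (hW : 2 ≤ W) (m : ℕ → ℕ) :
    (execOps W m S5) 35 = (if m 19 = 0 then 0 else 1) ∧
    ∀ a, a ∉ dests S5 → (execOps W m S5) a = m a := by
  have h4 : 4 ≤ 2 ^ W := by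
    have := Nat.pow_le_pow_right (show 0 < 2 by norm_num) hW; simpa using this
  refine ⟨?_, fun a ha => execOps_apply_of_not_mem_dests S5 m rfl ha⟩
  simp only [S5, execOps_cons, execOps_nil, execOp_dir, Operand.read_dir, Operand.read_ind,
    Operand.read_imm, BinOp.eval, Nat.div_one]
  simp (config := { decide := true }) only [Function.update_self, Function.update_of_ne, ne_eq]
  by_cases h0 : m 19 = 0
  · simp [h0]
  by_cases h1 : m 19 = 1
  · simp [h1, Nat.mod_eq_of_lt (show 1 < 2 ^ W by omega)]
  have h2 : 1 < m 19 := by omega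
  simp [h0, h1, h2, Nat.mod_eq_of_lt (show 1 < 2 ^ W by omega)]

/-- Semantics of S5, the target: with `B = m 8 ≥ 40` and the probed addresses words,
`R34 = B + (if dκ = 1 then dv else mem (B + dv))` whenever `dκ ≠ 0`. [folklore] -/
theorem execOps_S5_target {W : ℕ} (hW : 2 ≤ W) (m : ℕ → ℕ) (hB : 40 ≤ m 8)
    (h1 : m 8 + m 20 < 2 ^ W) (h2 : m 8 + m (m 8 + m 20) < 2 ^ W) (hκ : m 19 ≠ 0) :
    (execOps W m S5) 34 = m 8 + (if m 19 = 1 then m 20 else m (m 8 + m 20)) := by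
  have h4 : 4 ≤ 2 ^ W := by
    have := Nat.pow_le_pow_right (show 0 < 2 by norm_num) hW; simpa using this
  have n1 : m 8 + m 20 ≠ 27 := by omega
  simp only [S5, execOps_cons, execOps_nil, execOp_dir, Operand.read_dir, Operand.read_ind,
    Operand.read_imm, BinOp.eval, Nat.div_one]
  simp (config := { decide := true }) only [Function.update_self, Function.update_of_ne, ne_eq,
    Nat.mod_eq_of_lt h1, n1, Nat.mod_eq_of_lt h2, not_false_eq_true]
  by_cases e1 : m 19 = 1
  · simp [e1, Nat.mod_eq_of_lt h1]
  · have e2 : 1 < m 19 := by omega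
    simp [e1, e2, Nat.mod_eq_of_lt h2]

/-! ## Block S6: the instruction class

`36 := isOp = [1 ≤ opc ≤ 12]`, `37 := isJmp = [opc = 13]`, `38 := isJz = [opc = 14]`
(everything else — `opc = 0` and unknown opcodes — is `halt`). -/

/-- Block S6 (instruction class). [folklore] -/
def S6 : List OpSpec :=
  [(.lt, .dir 29, .imm 0, .dir 18), (.lt, .dir 30, .dir 18, .imm 13), (.mul, .dir 36, .dir 29, .dir 30),
   (.eq, .dir 37, .dir 18, .imm 13), (.eq, .dir 38, .dir 18, .imm 14)]

/-- Semantics of S6. [folklore] -/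
theorem execOps_S6 {W : ℕ} (hW : 2 ≤ W) (m : ℕ → ℕ) :
    (execOps W m S6) 36 = (if 0 < m 18 ∧ m 18 < 13 then 1 else 0) ∧
    (execOps W m S6) 37 = (if m 18 = 13 then 1 else 0) ∧
    (execOps W m S6) 38 = (if m 18 = 14 then 1 else 0) ∧
    ∀ a, a ∉ dests S6 → (execOps W m S6) a = m a := by
  have h4 : 4 ≤ 2 ^ W := by
    have := Nat.pow_le_pow_right (show 0 < 2 by norm_num) hW; simpa using this
  refine ⟨?_, ?_, ?_, fun a ha => execOps_apply_of_not_mem_dests S6 m rfl ha⟩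
  all_goals
    simp only [S6, execOps_cons, execOps_nil, execOp_dir, Operand.read_dir, Operand.read_imm,
      BinOp.eval]
    simp (config := { decide := true }) only [Function.update_self, Function.update_of_ne, ne_eq]
  by_cases ha : 0 < m 18 <;> by_cases hb : m 18 < 13 <;>
    simp [ha, hb, Nat.mod_eq_of_lt (show 1 < 2 ^ W by omega)]

/-! ## Block S7: the masked write target

`35 := wr = dm · isOp · go` (this round really writes the simulated memory) and
`34 := wr · dd + (1 - wr) · 39` (otherwise the write goes to the junk cell `39`). -/

/-- Block S7 (masked write target). [folklore] -/
def S7 : List OpSpec :=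
  [(.mul, .dir 35, .dir 35, .dir 36), (.mul, .dir 35, .dir 35, .dir 15), (.mul, .dir 34, .dir 34, .dir 35),
   (.sub, .dir 27, .imm 1, .dir 35), (.mul, .dir 27, .dir 27, .imm 39), (.add, .dir 34, .dir 34, .dir 27)]

/-- Semantics of S7 (masks `≤ 1`, `dd` a word, `W ≥ 6`). [folklore] -/
theorem execOps_S7 {W : ℕ} (hW : 6 ≤ W) (m : ℕ → ℕ) (h35 : m 35 ≤ 1) (h36 : m 36 ≤ 1)
    (h15 : m 15 ≤ 1) (h34 : m 34 < 2 ^ W) :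
    (execOps W m S7) 35 = m 35 * m 36 * m 15 ∧
    (execOps W m S7) 34 = (if m 35 * m 36 * m 15 = 1 then m 34 else 39) ∧
    ∀ a, a ∉ dests S7 → (execOps W m S7) a = m a := by
  have h64 : 64 ≤ 2 ^ W := by
    have := Nat.pow_le_pow_right (show 0 < 2 by norm_num) hW; simpa using this
  have hwr : m 35 * m 36 * m 15 ≤ 1 := by
    calc m 35 * m 36 * m 15 ≤ 1 * 1 * 1 :=
          Nat.mul_le_mul (Nat.mul_le_mul h35 h36) h15
      _ = 1 := rfl
  have hmm : m 35 * m 36 ≤ 1 := by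
    calc m 35 * m 36 ≤ 1 * 1 := Nat.mul_le_mul h35 h36
      _ = 1 := rfl
  have e1 : m 35 * m 36 % 2 ^ W = m 35 * m 36 := Nat.mod_eq_of_lt (by omega)
  refine ⟨?_, ?_, fun a ha => execOps_apply_of_not_mem_dests S7 m rfl ha⟩
  all_goals
    simp only [S7, execOps_cons, execOps_nil, execOp_dir, Operand.read_dir, Operand.read_imm,
      BinOp.eval]
    simp (config := { decide := true }) only [Function.update_self, Function.update_of_ne, ne_eq, e1]
  · exact Nat.mod_eq_of_lt (by omega)
  · rw [Nat.mod_eq_of_lt (a := m 35 * m 36 * m 15) (by omega), sub_eval_of_le hwr (by omega)]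
    rcases Nat.le_one_iff_eq_zero_or_eq_one.1 hwr with h | h
    · rw [h]; simp [Nat.mod_eq_of_lt (show 39 < 2 ^ W by omega)]
    · rw [h]; simp [Nat.mod_eq_of_lt h34]

/-! ## Block S8: the arithmetic-logic unit

All twelve operations are computed from `X = R32`, `Y = R33` at the large word size `W` and
reduced modulo `P₀ = R9 = 2 ^ w₀` where the `w₀`-bit semantics reduces (`+ × or xor shl`;
subtraction as `X + P₀ - Y mod P₀`); the result of operation `j` is added to the accumulator
`R29` with weight `[opc = j]`. -/

/-- The selector: `R29 += [opc = j] · R30`. [folklore] -/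
def sel (j : ℕ) : List OpSpec :=
  [(.eq, .dir 31, .dir 18, .imm j), (.mul, .dir 30, .dir 30, .dir 31), (.add, .dir 29, .dir 29, .dir 30)]

/-- Semantics of the selector. [folklore] -/
theorem execOps_sel {W : ℕ} (m : ℕ → ℕ) (j : ℕ) (h30 : m 30 < 2 ^ W)
    (hs : m 29 + (if m 18 = j then m 30 else 0) < 2 ^ W) :
    (execOps W m (sel j)) 29 = m 29 + (if m 18 = j then m 30 else 0) ∧
    ∀ a, a ∉ dests (sel j) → (execOps W m (sel j)) a = m a := by
  refine ⟨?_, fun a ha => execOps_apply_of_not_mem_dests (sel j) m rfl ha⟩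
  simp only [sel, execOps_cons, execOps_nil, execOp_dir, Operand.read_dir, Operand.read_imm,
    BinOp.eval]
  simp (config := { decide := true }) only [Function.update_self, Function.update_of_ne, ne_eq]
  by_cases h : m 18 = j
  · rw [if_pos h] at hs ⊢; rw [if_pos h, Nat.mul_one, Nat.mod_eq_of_lt h30, Nat.mod_eq_of_lt hs]
  · rw [if_neg h] at hs ⊢; rw [if_neg h, Nat.mul_zero, Nat.zero_mod, Nat.mod_eq_of_lt hs]

/-- The raw result of operation `j` on `X, Y` at word size `W` with modulus `P₀`, as computed by
the blocks `pre1, …, pre12` below. [folklore] -/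
def aluRaw (W j X Y P₀ : ℕ) : ℕ :=
  if j = 1 then (X + Y) % 2 ^ W % P₀
  else if j = 2 then ((X + P₀) % 2 ^ W + 2 ^ W - Y % P₀ % 2 ^ W) % 2 ^ W % P₀
  else if j = 3 then X * Y % 2 ^ W % P₀
  else if j = 4 then X / Y
  else if j = 5 then X % Y
  else if j = 6 then X &&& Y
  else if j = 7 then (X ||| Y) % 2 ^ W % P₀
  else if j = 8 then (X ^^^ Y) % 2 ^ W % P₀
  else if j = 9 then (X <<< Y) % 2 ^ W % P₀
  else if j = 10 then X >>> Y
  else if j = 11 then (if X < Y then 1 else 0)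
  else if j = 12 then (if X = Y then 1 else 0)
  else 0

/-- `add`: `30 := (X + Y) mod P₀`. [folklore] -/
def pre1 : List OpSpec := [(.add, .dir 30, .dir 32, .dir 33), (.mod, .dir 30, .dir 30, .dir 9)]
/-- `sub`: `30 := (X + P₀ - Y mod P₀) mod P₀`. [folklore] -/
def pre2 : List OpSpec := [(.mod, .dir 30, .dir 33, .dir 9), (.add, .dir 27, .dir 32, .dir 9),
  (.sub, .dir 30, .dir 27, .dir 30), (.mod, .dir 30, .dir 30, .dir 9)]
/-- `mul`: `30 := (X · Y) mod P₀`. [folklore] -/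
def pre3 : List OpSpec := [(.mul, .dir 30, .dir 32, .dir 33), (.mod, .dir 30, .dir 30, .dir 9)]
/-- `div`: `30 := X / Y`. [folklore] -/
def pre4 : List OpSpec := [(.div, .dir 30, .dir 32, .dir 33)]
/-- `mod`: `30 := X mod Y`. [folklore] -/
def pre5 : List OpSpec := [(.mod, .dir 30, .dir 32, .dir 33)]
/-- `band`: `30 := X and Y`. [folklore] -/
def pre6 : List OpSpec := [(.band, .dir 30, .dir 32, .dir 33)]
/-- `bor`: `30 := (X or Y) mod P₀`. [folklore] -/
def pre7 : List OpSpec := [(.bor, .dir 30, .dir 32, .dir 33), (.mod, .dir 30, .dir 30, .dir 9)]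
/-- `bxor`: `30 := (X xor Y) mod P₀`. [folklore] -/
def pre8 : List OpSpec := [(.bxor, .dir 30, .dir 32, .dir 33), (.mod, .dir 30, .dir 30, .dir 9)]
/-- `shl`: `30 := (X <<< Y) mod P₀`. [folklore] -/
def pre9 : List OpSpec := [(.shl, .dir 30, .dir 32, .dir 33), (.mod, .dir 30, .dir 30, .dir 9)]
/-- `shr`: `30 := X >>> Y`. [folklore] -/
def pre10 : List OpSpec := [(.shr, .dir 30, .dir 32, .dir 33)]
/-- `lt`: `30 := [X < Y]`. [folklore] -/
def pre11 : List OpSpec := [(.lt, .dir 30, .dir 32, .dir 33)]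
/-- `eq`: `30 := [X = Y]`. [folklore] -/
def pre12 : List OpSpec := [(.eq, .dir 30, .dir 32, .dir 33)]

/-- The computation of operation `j` (`[]` outside `1 … 12`). [folklore] -/
def pre (j : ℕ) : List OpSpec :=
  if j = 1 then pre1 else if j = 2 then pre2 else if j = 3 then pre3 else if j = 4 then pre4
  else if j = 5 then pre5 else if j = 6 then pre6 else if j = 7 then pre7 else if j = 8 then pre8
  else if j = 9 then pre9 else if j = 10 then pre10 else if j = 11 then pre11
  else if j = 12 then pre12 else []

/-- Semantics of `pre j` for `1 ≤ j ≤ 12`: `R30 := aluRaw W j X Y P₀`, only `27, 30` change. [folklore] -/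
theorem execOps_pre {W : ℕ} (m : ℕ → ℕ) {j : ℕ} (hj : 1 ≤ j) (hj' : j ≤ 12) :
    (execOps W m (pre j)) 30 = aluRaw W j (m 32) (m 33) (m 9) ∧
    ∀ a, a ≠ 27 → a ≠ 30 → (execOps W m (pre j)) a = m a := by
  have hcase : j = 1 ∨ j = 2 ∨ j = 3 ∨ j = 4 ∨ j = 5 ∨ j = 6 ∨ j = 7 ∨ j = 8 ∨ j = 9 ∨ j = 10 ∨
      j = 11 ∨ j = 12 := by omega
  rcases hcase with rfl | rfl | rfl | rfl | rfl | rfl | rfl | rfl | rfl | rfl | rfl | rfl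
  all_goals
    refine ⟨?_, fun a ha hb => ?_⟩
    · simp [pre, aluRaw, pre1, pre2, pre3, pre4, pre5, pre6, pre7, pre8, pre9, pre10, pre11, pre12,
        execOp_dir, BinOp.eval]
    · simp [pre, pre1, pre2, pre3, pre4, pre5, pre6, pre7, pre8, pre9, pre10, pre11, pre12,
        execOp_dir, BinOp.eval, ha, hb]

/-- Block `j` of the ALU: compute operation `j`, then select. [folklore] -/
def blk (j : ℕ) : List OpSpec := pre j ++ sel j

/-- The accumulator after the first `k` ALU blocks: the raw result if `1 ≤ opc ≤ k`, else `0`. [folklore] -/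
def aluAcc (W opc X Y P₀ k : ℕ) : ℕ :=
  if 1 ≤ opc ∧ opc ≤ k then aluRaw W opc X Y P₀ else 0

/-- Raw results are words (given that `X` is). [folklore] -/
theorem aluRaw_lt {W j X Y P₀ : ℕ} (hX : X < 2 ^ W) (hW : 1 ≤ W) :
    aluRaw W j X Y P₀ < 2 ^ W := by
  have h2 : 2 ≤ 2 ^ W := by
    have := Nat.pow_le_pow_right (show 0 < 2 by norm_num) hW; simpa using this
  have hpos : 0 < 2 ^ W := by omega
  have hmod : ∀ z, z % 2 ^ W % P₀ < 2 ^ W := fun z =>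
    lt_of_le_of_lt (Nat.mod_le _ _) (Nat.mod_lt _ hpos)
  have hand : X &&& Y ≤ X := Nat.and_le_left
  have hshr : X >>> Y ≤ X := Nat.shiftRight_le _ _
  have hdiv : X / Y ≤ X := Nat.div_le_self _ _
  have hmd : X % Y ≤ X := Nat.mod_le _ _
  unfold aluRaw
  by_cases h1 : j = 1; · rw [if_pos h1]; exact hmod _
  rw [if_neg h1]
  by_cases h2 : j = 2; · rw [if_pos h2]; exact hmod _
  rw [if_neg h2]
  by_cases h3 : j = 3; · rw [if_pos h3]; exact hmod _
  rw [if_neg h3]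
  by_cases h4 : j = 4; · rw [if_pos h4]; omega
  rw [if_neg h4]
  by_cases h5 : j = 5; · rw [if_pos h5]; omega
  rw [if_neg h5]
  by_cases h6 : j = 6; · rw [if_pos h6]; omega
  rw [if_neg h6]
  by_cases h7 : j = 7; · rw [if_pos h7]; exact hmod _
  rw [if_neg h7]
  by_cases h8 : j = 8; · rw [if_pos h8]; exact hmod _
  rw [if_neg h8]
  by_cases h9 : j = 9; · rw [if_pos h9]; exact hmod _
  rw [if_neg h9]
  by_cases h10 : j = 10; · rw [if_pos h10]; omega
  rw [if_neg h10]
  by_cases h11 : j = 11; · rw [if_pos h11]; split_ifs <;> omega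
  rw [if_neg h11]
  by_cases h12 : j = 12; · rw [if_pos h12]; split_ifs <;> omega
  rw [if_neg h12]; omega

/-- **One ALU block.** From an accumulator holding `aluAcc … k` (with `k + 1 ≤ 12`), block
`k + 1` leaves `aluAcc … (k + 1)`; only `27, 29, 30, 31` change. [folklore] -/
theorem execOps_blk {W : ℕ} (hW : 1 ≤ W) (m : ℕ → ℕ) {k : ℕ} (hk : k + 1 ≤ 12)
    (hX : m 32 < 2 ^ W) (hacc : m 29 = aluAcc W (m 18) (m 32) (m 33) (m 9) k) :
    (execOps W m (blk (k + 1))) 29 = aluAcc W (m 18) (m 32) (m 33) (m 9) (k + 1) ∧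
    ∀ a, a ∉ [27, 29, 30, 31] → (execOps W m (blk (k + 1))) a = m a := by
  obtain ⟨p30, pf⟩ := execOps_pre (W := W) m (j := k + 1) (by omega) hk
  set m₁ := execOps W m (pre (k + 1)) with hm₁
  have e18 : m₁ 18 = m 18 := pf _ (by omega) (by omega)
  have e29 : m₁ 29 = m 29 := pf _ (by omega) (by omega)
  have hraw : aluRaw W (k + 1) (m 32) (m 33) (m 9) < 2 ^ W := aluRaw_lt hX hW
  have hacc' : m₁ 29 + (if m₁ 18 = k + 1 then m₁ 30 else 0) =
      aluAcc W (m 18) (m 32) (m 33) (m 9) (k + 1) := by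
    rw [e18, e29, p30, hacc]
    unfold aluAcc
    by_cases h : m 18 = k + 1
    · rw [if_pos h, if_neg (by omega), if_pos (by omega), h]; simp
    · rw [if_neg h, Nat.add_zero]
      by_cases h' : 1 ≤ m 18 ∧ m 18 ≤ k
      · rw [if_pos h', if_pos (by omega)]
      · rw [if_neg h', if_neg (by omega)]
  have hlt : aluAcc W (m 18) (m 32) (m 33) (m 9) (k + 1) < 2 ^ W := by
    unfold aluAcc; split_ifs
    · exact aluRaw_lt hX hW
    · exact Nat.two_pow_pos W
  obtain ⟨s29, sf⟩ := execOps_sel (W := W) m₁ (k + 1) (by rw [p30]; exact hraw) (by rw [hacc']; exact hlt)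
  rw [blk, execOps_append]
  refine ⟨by rw [s29, hacc'], fun a ha => ?_⟩
  simp only [List.mem_cons, List.not_mem_nil, or_false, not_or] at ha
  obtain ⟨h27, h29, h30, h31⟩ := ha
  rw [sf a (by simp [dests, sel, h29, h30, h31]), pf a h27 h30]

/-- The first `k` ALU blocks. [folklore] -/
def blks : ℕ → List OpSpec
  | 0 => []
  | k + 1 => blks k ++ blk (k + 1)

/-- Block S8 (the ALU): clear the accumulator, then the twelve blocks. [folklore] -/
def S8 : List OpSpec := [(.add, .dir 29, .imm 0, .imm 0)] ++ blks 12

/-- Semantics of the first `k ≤ 12` ALU blocks from a cleared accumulator. [folklore] -/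
theorem execOps_blks {W : ℕ} (hW : 1 ≤ W) (m : ℕ → ℕ) (hX : m 32 < 2 ^ W)
    (h29 : m 29 = 0) : ∀ k, k ≤ 12 →
    (execOps W m (blks k)) 29 = aluAcc W (m 18) (m 32) (m 33) (m 9) k ∧
    ∀ a, a ∉ [27, 29, 30, 31] → (execOps W m (blks k)) a = m a
  | 0, _ => ⟨by simp only [blks, execOps_nil, aluAcc]; rw [if_neg (by omega), h29], fun a _ => rfl⟩
  | k + 1, hk => by
    obtain ⟨ih1, ih2⟩ := execOps_blks hW m hX h29 k (by omega)
    have e18 := ih2 18 (by decide)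
    have e32 := ih2 32 (by decide)
    have e33 := ih2 33 (by decide)
    have e9 := ih2 9 (by decide)
    obtain ⟨b1, b2⟩ := execOps_blk hW (execOps W m (blks k)) hk (by rw [e32]; exact hX)
      (by rw [ih1, e18, e32, e33, e9])
    rw [blks, execOps_append]
    refine ⟨by rw [b1, e18, e32, e33, e9], fun a ha => by rw [b2 a ha, ih2 a ha]⟩

/-- **Semantics of S8.** `R29 := aluRaw W opc X Y P₀` if `1 ≤ opc ≤ 12`, else `0`; only
`27, 29, 30, 31` change. [folklore] -/
theorem execOps_S8 {W : ℕ} (hW : 1 ≤ W) (m : ℕ → ℕ) (hX : m 32 < 2 ^ W) :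
    (execOps W m S8) 29 =
      (if 1 ≤ m 18 ∧ m 18 ≤ 12 then aluRaw W (m 18) (m 32) (m 33) (m 9) else 0) ∧
    ∀ a, a ∉ [27, 29, 30, 31] → (execOps W m S8) a = m a := by
  have h0 : ∀ a, (execOps W m [(.add, .dir 29, .imm 0, .imm 0)]) a = Function.update m 29 0 a := by
    intro a; simp [execOp_dir, BinOp.eval]
  have h0f : (execOps W m [(.add, .dir 29, .imm 0, .imm 0)]) = Function.update m 29 0 := funext h0
  rw [S8, execOps_append, h0f]
  obtain ⟨b1, b2⟩ := execOps_blks hW (Function.update m 29 0) (by simpa using hX) (by simp) 12 le_rfl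
  refine ⟨by rw [b1]; simp [aluAcc], fun a ha => ?_⟩
  rw [b2 a ha, Function.update_of_ne]
  simp only [List.mem_cons, List.not_mem_nil, or_false, not_or] at ha
  exact ha.2.1

/-- **The ALU is correct**: for `1 ≤ opc ≤ 12`, `P₀ = 2 ^ w₀ ∣ 2 ^ W`, words `X, Y` with
`X + P₀ < 2 ^ W`, the raw result is the `w₀`-bit semantics of the decoded operation. [folklore] -/
theorem aluRaw_eq_eval {W w₀ opc X Y : ℕ} (h1 : 1 ≤ opc) (h12 : opc ≤ 12) (hw : w₀ ≤ W)
    (hX : X + 2 ^ w₀ < 2 ^ W) :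
    aluRaw W opc X Y (2 ^ w₀) = (BinOp.decode opc).eval w₀ X Y := by
  have hdvd : 2 ^ w₀ ∣ 2 ^ W := Nat.pow_dvd_pow 2 hw
  have hP : 0 < 2 ^ w₀ := Nat.two_pow_pos w₀
  have hcase : opc = 1 ∨ opc = 2 ∨ opc = 3 ∨ opc = 4 ∨ opc = 5 ∨ opc = 6 ∨ opc = 7 ∨ opc = 8 ∨
      opc = 9 ∨ opc = 10 ∨ opc = 11 ∨ opc = 12 := by omega
  rcases hcase with rfl | h2 | rfl | rfl | rfl | rfl | rfl | rfl | rfl | rfl | rfl | rfl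
  · simp [aluRaw, BinOp.decode, BinOp.eval, Nat.mod_mod_of_dvd _ hdvd]
  · -- subtraction
    subst h2
    have hy : Y % 2 ^ w₀ < 2 ^ w₀ := Nat.mod_lt _ hP
    rw [show BinOp.decode 2 = BinOp.sub from rfl]
    simp only [aluRaw, BinOp.eval, show (2:ℕ) ≠ 1 by decide, if_false, if_true]
    rw [Nat.mod_eq_of_lt hX, Nat.mod_eq_of_lt (show Y % 2 ^ w₀ < 2 ^ W by omega),
      show X + 2 ^ w₀ + 2 ^ W - Y % 2 ^ w₀ = (X + 2 ^ w₀ - Y % 2 ^ w₀) + 2 ^ W by omega,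
      Nat.add_mod_right, Nat.mod_eq_of_lt (show X + 2 ^ w₀ - Y % 2 ^ w₀ < 2 ^ W by omega)]
  all_goals simp [aluRaw, BinOp.decode, BinOp.eval, Nat.mod_mod_of_dvd _ hdvd]

/-! ## Block S9: the write -/

/-- Block S9: `mem[R34] := R29`. [folklore] -/
def S9 : List OpSpec := [(.div, .ind 34, .dir 29, .imm 1)]

/-- Semantics of S9. [folklore] -/
theorem execOps_S9 {W : ℕ} (m : ℕ → ℕ) : execOps W m S9 = Function.update m (m 34) (m 29) := by
  simp [S9, execOp_ind, BinOp.eval]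

/-! ## Block S10: new program counter and halting flag

`S10a` computes the candidate program counter
`30 := isOp · (PC + 1) + isJmp · t + isJz · ([X = 0] · t + [X ≠ 0] · (PC + 1))`;
`S10b` sets `H += go · (1 - isOp - isJmp - isJz)` (a `halt` was executed) and
`PC := J · R30 + (1 - J) · PC` with `J = go · (isOp + isJmp + isJz)`. -/

/-- Block S10a (candidate program counter). [folklore] -/
def S10a : List OpSpec :=
  [(.eq, .dir 27, .dir 32, .imm 0), (.add, .dir 28, .dir 11, .imm 1), (.mul, .dir 30, .dir 27, .dir 25),
   (.sub, .dir 31, .imm 1, .dir 27), (.mul, .dir 31, .dir 31, .dir 28), (.add, .dir 30, .dir 30, .dir 31),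
   (.mul, .dir 30, .dir 30, .dir 38), (.mul, .dir 31, .dir 37, .dir 25), (.add, .dir 30, .dir 30, .dir 31),
   (.mul, .dir 31, .dir 36, .dir 28), (.add, .dir 30, .dir 30, .dir 31)]

/-- The candidate program counter. [folklore] -/
def newPC (isOp isJmp isJz X t p : ℕ) : ℕ :=
  isOp * (p + 1) + isJmp * t + isJz * (if X = 0 then t else p + 1)

/-- Semantics of S10a (masks `≤ 1` and pairwise exclusive, `t` and `PC + 1` words). [folklore] -/
theorem execOps_S10a {W : ℕ} (hW : 2 ≤ W) (m : ℕ → ℕ) (h36 : m 36 ≤ 1) (h37 : m 37 ≤ 1)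
    (h38 : m 38 ≤ 1) (hex : m 36 + m 37 + m 38 ≤ 1) (ht : m 25 < 2 ^ W) (hp : m 11 + 1 < 2 ^ W) :
    (execOps W m S10a) 30 = newPC (m 36) (m 37) (m 38) (m 32) (m 25) (m 11) ∧
    (execOps W m S10a) 28 = m 11 + 1 ∧
    ∀ a, a ∉ dests S10a → (execOps W m S10a) a = m a := by
  have h4 : 4 ≤ 2 ^ W := by
    have := Nat.pow_le_pow_right (show 0 < 2 by norm_num) hW; simpa using this
  refine ⟨?_, ?_, fun a ha => execOps_apply_of_not_mem_dests S10a m rfl ha⟩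
  all_goals
    simp only [S10a, execOps_cons, execOps_nil, execOp_dir, Operand.read_dir, Operand.read_imm,
      BinOp.eval]
    simp (config := { decide := true }) only [Function.update_self, Function.update_of_ne, ne_eq,
      Nat.mod_eq_of_lt hp]
  unfold newPC
  rcases Nat.le_one_iff_eq_zero_or_eq_one.1 h36 with e36 | e36 <;>
  rcases Nat.le_one_iff_eq_zero_or_eq_one.1 h37 with e37 | e37 <;>
  rcases Nat.le_one_iff_eq_zero_or_eq_one.1 h38 with e38 | e38 <;>
  simp only [e36, e37, e38] at hex ⊢ <;>
  by_cases hz : m 32 = 0 <;>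
  simp [hz, Nat.mod_eq_of_lt ht, Nat.mod_eq_of_lt hp, Nat.mod_eq_of_lt (show 1 < 2 ^ W by omega)] <;>
  omega

/-- Block S10b (commit program counter and halting flag). [folklore] -/
def S10b : List OpSpec :=
  [(.add, .dir 13, .dir 36, .dir 37), (.add, .dir 13, .dir 13, .dir 38),
   (.sub, .dir 14, .imm 1, .dir 13), (.mul, .dir 14, .dir 14, .dir 15), (.add, .dir 12, .dir 12, .dir 14),
   (.mul, .dir 13, .dir 13, .dir 15), (.mul, .dir 30, .dir 30, .dir 13),
   (.sub, .dir 14, .imm 1, .dir 13), (.mul, .dir 14, .dir 14, .dir 11), (.add, .dir 11, .dir 30, .dir 14)]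

/-- Semantics of S10b: with `nh = isOp + isJmp + isJz ≤ 1`, `go ≤ 1`, `H + go · (1 - nh) ≤ 1`,
`R30` and `PC` words: `H := H + go · (1 - nh)`, `PC := if go · nh = 1 then R30 else PC`. [folklore] -/
theorem execOps_S10b {W : ℕ} (hW : 2 ≤ W) (m : ℕ → ℕ) (hnh : m 36 + m 37 + m 38 ≤ 1)
    (h15 : m 15 ≤ 1) (hH : m 12 + m 15 * (1 - (m 36 + m 37 + m 38)) ≤ 1) (h30 : m 30 < 2 ^ W)
    (h11 : m 11 < 2 ^ W) :
    (execOps W m S10b) 12 = m 12 + m 15 * (1 - (m 36 + m 37 + m 38)) ∧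
    (execOps W m S10b) 11 = (if m 15 * (m 36 + m 37 + m 38) = 1 then m 30 else m 11) ∧
    ∀ a, a ∉ dests S10b → (execOps W m S10b) a = m a := by
  have h4 : 4 ≤ 2 ^ W := by
    have := Nat.pow_le_pow_right (show 0 < 2 by norm_num) hW; simpa using this
  refine ⟨?_, ?_, fun a ha => execOps_apply_of_not_mem_dests S10b m rfl ha⟩
  all_goals
    simp only [S10b, execOps_cons, execOps_nil, execOp_dir, Operand.read_dir, Operand.read_imm,
      BinOp.eval]
    simp (config := { decide := true }) only [Function.update_self, Function.update_of_ne, ne_eq]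
  all_goals
    have h1mod : 1 % 2 ^ W = 1 := Nat.mod_eq_of_lt (by omega)
    have e1 : (m 36 + m 37) % 2 ^ W = m 36 + m 37 := Nat.mod_eq_of_lt (by omega)
    have e2 : (m 36 + m 37 + m 38) % 2 ^ W = m 36 + m 37 + m 38 := Nat.mod_eq_of_lt (by omega)
    have e3 : (1 + 2 ^ W) % 2 ^ W = 1 := by rw [Nat.add_mod_right, h1mod]
    have e12 : m 12 % 2 ^ W = m 12 := Nat.mod_eq_of_lt (by omega)
    simp only [e1, e2]
    rcases Nat.le_one_iff_eq_zero_or_eq_one.1 h15 with e15 | e15 <;>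
    rcases Nat.le_one_iff_eq_zero_or_eq_one.1 hnh with e | e <;>
    simp [e15, e, h1mod, e3, e12, Nat.mod_eq_of_lt h11, Nat.mod_eq_of_lt h30, Nat.mod_self] <;>
    simp [e15, e] at hH ⊢ <;>
    first
    | omega
    | (rw [Nat.mod_eq_of_lt (show m 12 + 1 < 2 ^ W by omega)])

/-! ## Block S11 and the whole round -/

/-- Block S11: the fuel counter. [folklore] -/
def S11 : List OpSpec := [(.sub, .dir 10, .dir 10, .imm 1)]

/-- Semantics of S11 (`1 ≤ fuel < 2 ^ W`). [folklore] -/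
theorem execOps_S11 {W : ℕ} (m : ℕ → ℕ) (h1 : 1 ≤ m 10) (h2 : m 10 < 2 ^ W) :
    execOps W m S11 = Function.update m 10 (m 10 - 1) := by
  simp [S11, execOp_dir, BinOp.eval, sub_eval_of_le h1 h2]

/-- **The interpreter round**: flags, fetch, operands, destination, class, target, ALU, write,
program counter / halting flag, fuel. [folklore] -/
def STEP : List OpSpec :=
  S1 ++ S2 ++ opnd 21 22 32 ++ opnd 23 24 33 ++ S5 ++ S6 ++ S7 ++ S8 ++ S9 ++ S10a ++ S10b ++ S11

/-! ## Bookkeeping: destinations and constants of the blocks -/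

/-- A cell `≥ 40` is not a destination of register code whose destinations are `< 40`. [folklore] -/
theorem not_mem_dests_of_le {ops : List OpSpec} {a : ℕ} (h : ∀ r ∈ dests ops, r < 40) (ha : 40 ≤ a) :
    a ∉ dests ops := fun hm => absurd (h a hm) (by omega)

/-- Destinations of S1 are registers. [folklore] -/
theorem dests_S1 : ∀ r ∈ dests S1, r < 40 := by decide
/-- Destinations of the operand blocks are registers. [folklore] -/
theorem dests_opndX : ∀ r ∈ dests (opnd 21 22 32), r < 40 := by decide
/-- Destinations of the operand blocks are registers. [folklore] -/
theorem dests_opndY : ∀ r ∈ dests (opnd 23 24 33), r < 40 := by decide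
/-- Destinations of S5 are registers. [folklore] -/
theorem dests_S5 : ∀ r ∈ dests S5, r < 40 := by decide
/-- Destinations of S6 are registers. [folklore] -/
theorem dests_S6 : ∀ r ∈ dests S6, r < 40 := by decide
/-- Destinations of S7 are registers. [folklore] -/
theorem dests_S7 : ∀ r ∈ dests S7, r < 40 := by decide
/-- Destinations of S10a are registers. [folklore] -/
theorem dests_S10a : ∀ r ∈ dests S10a, r < 40 := by decide
/-- Destinations of S10b are registers. [folklore] -/
theorem dests_S10b : ∀ r ∈ dests S10b, r < 40 := by decide

/-- Constants of S1. [folklore] -/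
theorem maxConst_S1 : ∀ s ∈ S1, OpSpec.maxConst s ≤ 44 := by decide
/-- Constants of S2. [folklore] -/
theorem maxConst_S2 : ∀ s ∈ S2, OpSpec.maxConst s ≤ 44 := by decide
/-- Constants of the operand blocks. [folklore] -/
theorem maxConst_opndX : ∀ s ∈ opnd 21 22 32, OpSpec.maxConst s ≤ 44 := by decide
/-- Constants of the operand blocks. [folklore] -/
theorem maxConst_opndY : ∀ s ∈ opnd 23 24 33, OpSpec.maxConst s ≤ 44 := by decide
/-- Constants of S5. [folklore] -/
theorem maxConst_S5 : ∀ s ∈ S5, OpSpec.maxConst s ≤ 44 := by decide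
/-- Constants of S6. [folklore] -/
theorem maxConst_S6 : ∀ s ∈ S6, OpSpec.maxConst s ≤ 44 := by decide
/-- Constants of S7. [folklore] -/
theorem maxConst_S7 : ∀ s ∈ S7, OpSpec.maxConst s ≤ 44 := by decide
/-- Constants of one ALU block. [folklore] -/
theorem maxConst_blk {j : ℕ} (hj : 1 ≤ j) (hj' : j ≤ 12) : ∀ s ∈ blk j, OpSpec.maxConst s ≤ 44 := by
  have hcase : j = 1 ∨ j = 2 ∨ j = 3 ∨ j = 4 ∨ j = 5 ∨ j = 6 ∨ j = 7 ∨ j = 8 ∨ j = 9 ∨ j = 10 ∨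
      j = 11 ∨ j = 12 := by omega
  rcases hcase with rfl | rfl | rfl | rfl | rfl | rfl | rfl | rfl | rfl | rfl | rfl | rfl <;> decide
/-- Constants of the first `k ≤ 12` ALU blocks. [folklore] -/
theorem maxConst_blks : ∀ k, k ≤ 12 → ∀ s ∈ blks k, OpSpec.maxConst s ≤ 44
  | 0, _ => by simp [blks]
  | k + 1, hk => by
    intro s hs
    rw [blks, List.mem_append] at hs
    rcases hs with hs | hs
    · exact maxConst_blks k (by omega) s hs
    · exact maxConst_blk (by omega) hk s hs
/-- Constants of S8. [folklore] -/
theorem maxConst_S8 : ∀ s ∈ S8, OpSpec.maxConst s ≤ 44 := by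
  intro s hs
  rw [S8, List.mem_append] at hs
  rcases hs with hs | hs
  · simp only [List.mem_singleton] at hs; subst hs; decide
  · exact maxConst_blks 12 le_rfl s hs
/-- Constants of S10a. [folklore] -/
theorem maxConst_S10a : ∀ s ∈ S10a, OpSpec.maxConst s ≤ 44 := by decide
/-- Constants of S10b. [folklore] -/
theorem maxConst_S10b : ∀ s ∈ S10b, OpSpec.maxConst s ≤ 44 := by decide

/-- Straight-line code with constants `≤ 44` keeps all cells words (`W ≥ 6`). [folklore] -/
theorem memLE_execOps_of_maxConst {W : ℕ} (hW : 6 ≤ W) {ops : List OpSpec}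
    (hc : ∀ s ∈ ops, OpSpec.maxConst s ≤ 44) {m : ℕ → ℕ} (hm : MemLE (2 ^ W - 1) m) :
    MemLE (2 ^ W - 1) (execOps W m ops) := by
  have h64 : 64 ≤ 2 ^ W := by
    have := Nat.pow_le_pow_right (show 0 < 2 by norm_num) hW; simpa using this
  exact execOps_memLE le_rfl (by omega) ops hm fun s hs => le_trans (hc s hs) (by omega)

/-! ## The passive round: halted, or program counter out of range -/

/-- **A passive round.** If the simulated machine is halted (`H = 1`) or its program counter is
out of range (`PC ≥ |P|`), the round sets `H := 1`, keeps `PC`, decrements the fuel, and changes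
no cell `≥ 40` (the only memory write goes to the junk cell `39`). [folklore] -/
theorem round_passive {W V : ℕ} (hW : 6 ≤ W) {m : ℕ → ℕ} (hm : MemLE (2 ^ W - 1) m)
    (h11 : m 11 ≤ V) (h12 : m 12 ≤ 1)
    (hpass : m 12 = 1 ∨ m 42 ≤ m 11) (hgeom : 8 * V + 52 ≤ 2 ^ W) (h10 : 1 ≤ m 10) :
    (execOps W m STEP) 12 = 1 ∧ (execOps W m STEP) 11 = m 11 ∧
    (execOps W m STEP) 10 = m 10 - 1 ∧ (execOps W m STEP) 8 = m 8 ∧ (execOps W m STEP) 9 = m 9 ∧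
    (∀ a, 40 ≤ a → (execOps W m STEP) a = m a) ∧ MemLE (2 ^ W - 1) (execOps W m STEP) := by
  have h64 : 64 ≤ 2 ^ W := by
    have := Nat.pow_le_pow_right (show 0 < 2 by norm_num) hW; simpa using this
  have hw : ∀ {m' : ℕ → ℕ}, MemLE (2 ^ W - 1) m' → ∀ a, m' a < 2 ^ W := fun h a => by
    have := h a; omega
  -- S1
  obtain ⟨a15, a16, a12, af⟩ := execOps_S1 (show 2 ≤ W by omega) m h12
  set m1 := execOps W m S1 with hm1
  have hgo : m1 15 = 0 := by
    rw [a15]; rcases hpass with h | h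
    · rw [h]; simp
    · rw [if_neg (by omega)]; simp
  have hH1 : m1 12 = 1 := by
    rw [a12]; rcases hpass with h | h
    · rw [h]; simp
    · rw [if_neg (by omega)]; omega
  have w1 : MemLE (2 ^ W - 1) m1 := memLE_execOps_of_maxConst hW maxConst_S1 hm
  have f1 : ∀ a, a ∉ dests S1 → m1 a = m a := af
  -- S2
  have p11 : m1 11 = m 11 := f1 11 (by decide)
  obtain ⟨-, bf⟩ := execOps_S2 (W := W) m1 (p := m 11) p11 (by omega)
  set m2 := execOps W m1 S2 with hm2
  have w2 : MemLE (2 ^ W - 1) m2 := memLE_execOps_of_maxConst hW maxConst_S2 w1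
  -- operands (frames only)
  have cf := execOps_opnd_frame (W := W) m2 21 22 32
  set m3 := execOps W m2 (opnd 21 22 32) with hm3
  have w3 : MemLE (2 ^ W - 1) m3 := memLE_execOps_of_maxConst hW maxConst_opndX w2
  have df := execOps_opnd_frame (W := W) m3 23 24 33
  set m4 := execOps W m3 (opnd 23 24 33) with hm4
  have w4 : MemLE (2 ^ W - 1) m4 := memLE_execOps_of_maxConst hW maxConst_opndY w3
  -- S5 (mask only), S6
  obtain ⟨e35, ef⟩ := execOps_S5_mask (show 2 ≤ W by omega) m4
  set m5 := execOps W m4 S5 with hm5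
  have w5 : MemLE (2 ^ W - 1) m5 := memLE_execOps_of_maxConst hW maxConst_S5 w4
  obtain ⟨g36, g37, g38, gf⟩ := execOps_S6 (show 2 ≤ W by omega) m5
  set m6 := execOps W m5 S6 with hm6
  have w6 : MemLE (2 ^ W - 1) m6 := memLE_execOps_of_maxConst hW maxConst_S6 w5
  -- S7: the write is redirected to the junk cell
  have s35 : m6 35 ≤ 1 := by rw [gf 35 (by decide), e35]; split_ifs <;> omega
  have s36 : m6 36 ≤ 1 := by rw [g36]; split_ifs <;> omega
  have s15 : m6 15 = 0 := by
    rw [gf 15 (by decide), ef 15 (by decide), df 15 (by decide), cf 15 (by decide),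
      bf 15 (by omega), hgo]
  obtain ⟨-, i34, jf⟩ := execOps_S7 hW m6 s35 s36 (by omega) (hw w6 34)
  set m7 := execOps W m6 S7 with hm7
  have t34 : m7 34 = 39 := by rw [i34, s15]; simp
  have w7 : MemLE (2 ^ W - 1) m7 := memLE_execOps_of_maxConst hW maxConst_S7 w6
  -- S8, S9
  obtain ⟨-, kf⟩ := execOps_S8 (show 1 ≤ W by omega) m7 (hw w7 32)
  set m8 := execOps W m7 S8 with hm8
  have w8 : MemLE (2 ^ W - 1) m8 := memLE_execOps_of_maxConst hW maxConst_S8 w7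
  have u34 : m8 34 = 39 := by rw [kf 34 (by decide), t34]
  have e9 : execOps W m8 S9 = Function.update m8 39 (m8 29) := by rw [execOps_S9, u34]
  set m9 := execOps W m8 S9 with hm9
  have w9 : MemLE (2 ^ W - 1) m9 := by
    rw [e9]; intro a; rcases eq_or_ne a 39 with rfl | h
    · rw [Function.update_self]; exact w8 _
    · rw [Function.update_of_ne h]; exact w8 _
  have nf : ∀ a, a ≠ 39 → m9 a = m8 a := fun a ha => by rw [e9, Function.update_of_ne ha]
  -- S10a, S10b
  have v36 : m9 36 = m6 36 := by rw [nf 36 (by decide), kf 36 (by decide), jf 36 (by decide)]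
  have v37 : m9 37 = m6 37 := by rw [nf 37 (by decide), kf 37 (by decide), jf 37 (by decide)]
  have v38 : m9 38 = m6 38 := by rw [nf 38 (by decide), kf 38 (by decide), jf 38 (by decide)]
  have x36 : m9 36 ≤ 1 := by rw [v36]; exact s36
  have x37 : m9 37 ≤ 1 := by rw [v37, g37]; split_ifs <;> omega
  have x38 : m9 38 ≤ 1 := by rw [v38, g38]; split_ifs <;> omega
  have xex : m9 36 + m9 37 + m9 38 ≤ 1 := by
    rw [v36, v37, v38, g36, g37, g38]; split_ifs <;> omega
  have x11 : m9 11 = m 11 := by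
    rw [nf 11 (by decide), kf 11 (by decide), jf 11 (by decide), gf 11 (by decide), ef 11 (by decide),
      df 11 (by decide), cf 11 (by decide), bf 11 (by omega), p11]
  obtain ⟨-, -, lf⟩ := execOps_S10a (show 2 ≤ W by omega) m9 x36 x37 x38 xex (hw w9 25) (by rw [x11]; omega)
  set m10 := execOps W m9 S10a with hm10
  have w10 : MemLE (2 ^ W - 1) m10 := memLE_execOps_of_maxConst hW maxConst_S10a w9
  have y15 : m10 15 = 0 := by
    rw [lf 15 (by decide), nf 15 (by decide), kf 15 (by decide), jf 15 (by decide), s15]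
  have y12 : m10 12 = 1 := by
    rw [lf 12 (by decide), nf 12 (by decide), kf 12 (by decide), jf 12 (by decide), gf 12 (by decide),
      ef 12 (by decide), df 12 (by decide), cf 12 (by decide), bf 12 (by omega), hH1]
  have ynh : m10 36 + m10 37 + m10 38 ≤ 1 := by
    rw [lf 36 (by decide), lf 37 (by decide), lf 38 (by decide)]; exact xex
  obtain ⟨z12, z11, zf⟩ := execOps_S10b (show 2 ≤ W by omega) m10 ynh (by rw [y15]; omega)
    (by rw [y12, y15]; omega) (hw w10 30) (hw w10 11)
  set m11 := execOps W m10 S10b with hm11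
  have w11 : MemLE (2 ^ W - 1) m11 := memLE_execOps_of_maxConst hW maxConst_S10b w10
  have r12 : m11 12 = 1 := by rw [z12, y12, y15]; simp
  have r11 : m11 11 = m 11 := by rw [z11, y15, lf 11 (by decide), x11]; simp
  have r10 : m11 10 = m 10 := by
    rw [zf 10 (by decide), lf 10 (by decide), nf 10 (by decide), kf 10 (by decide), jf 10 (by decide),
      gf 10 (by decide), ef 10 (by decide), df 10 (by decide), cf 10 (by decide), bf 10 (by omega),
      f1 10 (by decide)]
  -- S11
  have e11 : execOps W m11 S11 = Function.update m11 10 (m11 10 - 1) :=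
    execOps_S11 m11 (by rw [r10]; exact h10) (hw w11 10)
  -- assemble
  have hSTEP : execOps W m STEP = execOps W m11 S11 := by
    simp only [STEP, execOps_append, hm1, hm2, hm3, hm4, hm5, hm6, hm7, hm8, hm9, hm10, hm11]
  rw [hSTEP, e11]
  have hi : ∀ a, 40 ≤ a → m11 a = m a := fun a ha => by
    rw [zf a (not_mem_dests_of_le dests_S10b ha), lf a (not_mem_dests_of_le dests_S10a ha),
      nf a (by omega), kf a (by simp; omega), jf a (not_mem_dests_of_le dests_S7 ha),
      gf a (not_mem_dests_of_le dests_S6 ha), ef a (not_mem_dests_of_le dests_S5 ha),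
      df a (not_mem_dests_of_le dests_opndY ha), cf a (not_mem_dests_of_le dests_opndX ha),
      bf a (by omega), f1 a (not_mem_dests_of_le dests_S1 ha)]
  refine ⟨?_, ?_, ?_, ?_, ?_, fun a ha => ?_, ?_⟩
  · rw [Function.update_of_ne (by decide), r12]
  · rw [Function.update_of_ne (by decide), r11]
  · rw [Function.update_self, r10]
  · rw [Function.update_of_ne (by decide), zf 8 (by decide), lf 8 (by decide), nf 8 (by decide),
      kf 8 (by decide), jf 8 (by decide), gf 8 (by decide), ef 8 (by decide), df 8 (by decide),
      cf 8 (by decide), bf 8 (by omega), f1 8 (by decide)]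
  · rw [Function.update_of_ne (by decide), zf 9 (by decide), lf 9 (by decide), nf 9 (by decide),
      kf 9 (by decide), jf 9 (by decide), gf 9 (by decide), ef 9 (by decide), df 9 (by decide),
      cf 9 (by decide), bf 9 (by omega), f1 9 (by decide)]
  · rw [Function.update_of_ne (by omega), hi a ha]
  · intro a; rcases eq_or_ne a 10 with rfl | h
    · rw [Function.update_self]; have := w11 10; omega
    · rw [Function.update_of_ne h]; exact w11 a

/-! ## The active round: an instruction is executed -/

/-- Reading a decoded operand only depends on the memory below the value bound. [folklore] -/
theorem read_decode_congr {κ v V : ℕ} {f g : ℕ → ℕ} (hv : v ≤ V) (hg : MemLE V g)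
    (h : ∀ a, a ≤ V → f a = g a) : (Operand.decode κ v).read f = (Operand.decode κ v).read g := by
  rw [Operand.read_decode, Operand.read_decode]
  split_ifs
  · rfl
  · exact h v hv
  · rw [h v hv, h _ (hg v)]

/-- **An active round.** If the simulated machine is running (`H = 0`) with program counter
`p < |P|`, and the eight fields `F 0, …, F 7` of instruction `p` are in the code area, then after
the round: `H = 1` iff the instruction is `halt`-like (opcode `0` or unknown); `PC` is the new
program counter (`p + 1` for operations, the target for `jmp`, target or `p + 1` for `jz`);
the simulated memory (cells `B + a`, `a ≤ V`) is updated exactly by the write of an operation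
through its destination operand with the `w₀`-bit result; fuel is decremented; constants, the
code area and everything else `≥ 40` outside the simulated memory are unchanged. [folklore] -/
theorem round_active {W B V w₀ p nP : ℕ} (hW : 6 ≤ W) {m : ℕ → ℕ} (hm : MemLE (2 ^ W - 1) m)
    (h8 : m 8 = B) (h9 : m 9 = 2 ^ w₀) (h11 : m 11 = p) (h12 : m 12 = 0) (h42 : m 42 = nP)
    (hp : p < nP) (hnP : nP ≤ V) (h10 : 1 ≤ m 10)
    (hB : 44 + 8 * V + 8 ≤ B) (hBV : B + V < 2 ^ W) (hVw : V + 2 ^ w₀ < 2 ^ W)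
    {F : ℕ → ℕ} (hF : ∀ f, f < 8 → m (44 + 8 * p + f) = F f) (hFV : ∀ f, f < 8 → F f ≤ V)
    {cm : ℕ → ℕ} (hreg : ∀ a, a ≤ V → m (B + a) = cm a) (hcm : MemLE V cm) :
    let X := (Operand.decode (F 3) (F 4)).read cm
    let Y := (Operand.decode (F 5) (F 6)).read cm
    let isOp : ℕ := if 0 < F 0 ∧ F 0 < 13 then 1 else 0
    let isJmp : ℕ := if F 0 = 13 then 1 else 0
    let isJz : ℕ := if F 0 = 14 then 1 else 0
    let wa : ℕ := if F 1 = 1 then F 2 else cm (F 2)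
    (execOps W m STEP) 12 = 1 - (isOp + isJmp + isJz) ∧
    (execOps W m STEP) 11 =
      (if isOp + isJmp + isJz = 1 then newPC isOp isJmp isJz X (F 7) p else p) ∧
    (execOps W m STEP) 10 = m 10 - 1 ∧ (execOps W m STEP) 8 = m 8 ∧ (execOps W m STEP) 9 = m 9 ∧
    (∀ a, 40 ≤ a → (a < B ∨ B + V < a) → (execOps W m STEP) a = m a) ∧
    (∀ a, a ≤ V → (execOps W m STEP) (B + a) =
      (if (0 < F 0 ∧ F 0 < 13) ∧ F 1 ≠ 0 then Function.update cm wa (aluRaw W (F 0) X Y (2 ^ w₀))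
       else cm) a) ∧
    MemLE (2 ^ W - 1) (execOps W m STEP) := by
  intro X Y isOp isJmp isJz wa
  have h64 : 64 ≤ 2 ^ W := by
    have := Nat.pow_le_pow_right (show 0 < 2 by norm_num) hW; simpa using this
  have hw : ∀ {m' : ℕ → ℕ}, MemLE (2 ^ W - 1) m' → ∀ a, m' a < 2 ^ W := fun h a => by
    have := h a; omega
  have hpV : p ≤ V := by omega
  have hwaV : wa ≤ V := by
    simp only [wa]; split_ifs
    · exact hFV 2 (by omega)
    · exact hcm _
  have hXV : X ≤ V := Operand.read_le hcm _ (by rw [Operand.const_decode]; exact hFV 4 (by omega))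
  -- S1
  obtain ⟨a15, -, a12, f1⟩ := execOps_S1 (show 2 ≤ W by omega) m (by omega)
  set m1 := execOps W m S1 with hm1
  have hgo : m1 15 = 1 := by rw [a15, h12, h11, h42, if_pos hp]
  have hH1 : m1 12 = 0 := by rw [a12, h12, h11, h42, if_pos hp]
  have w1 : MemLE (2 ^ W - 1) m1 := memLE_execOps_of_maxConst hW maxConst_S1 hm
  have hi1 : ∀ a, 40 ≤ a → m1 a = m a := fun a ha => f1 a (not_mem_dests_of_le dests_S1 ha)
  -- S2
  have p11 : m1 11 = p := by rw [f1 11 (by decide), h11]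
  obtain ⟨bv, bf⟩ := execOps_S2 (W := W) m1 p11 (by omega)
  set m2 := execOps W m1 S2 with hm2
  have w2 : MemLE (2 ^ W - 1) m2 := memLE_execOps_of_maxConst hW maxConst_S2 w1
  have hi2 : ∀ a, 40 ≤ a → m2 a = m a := fun a ha => by rw [bf a (by omega), hi1 a ha]
  have fld : ∀ f, f < 8 → m2 (18 + f) = F f := fun f hf => by
    rw [bv f hf, hi1 _ (by omega), hF f hf]
  have o18 : m2 18 = F 0 := fld 0 (by omega)
  have o19 : m2 19 = F 1 := fld 1 (by omega)
  have o20 : m2 20 = F 2 := fld 2 (by omega)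
  have o21 : m2 21 = F 3 := fld 3 (by omega)
  have o22 : m2 22 = F 4 := fld 4 (by omega)
  have o23 : m2 23 = F 5 := fld 5 (by omega)
  have o24 : m2 24 = F 6 := fld 6 (by omega)
  have o25 : m2 25 = F 7 := fld 7 (by omega)
  have b8 : m2 8 = B := by rw [bf 8 (by omega), f1 8 (by decide), h8]
  have reg2 : ∀ a, a ≤ V → m2 (B + a) = cm a := fun a ha => by rw [hi2 _ (by omega), hreg a ha]
  -- operand X
  obtain ⟨cv, cf⟩ := execOps_opnd (W := W) m2 (κr := 21) (vr := 22) (out := 32) (by omega) (by omega)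
    (by omega) (hw w2) (by rw [b8]; omega)
    (by rw [b8, o22]; have := hFV 4 (by omega); omega)
    (by rw [b8, o22, reg2 _ (hFV 4 (by omega))]; have := hcm (F 4); omega)
  set m3 := execOps W m2 (opnd 21 22 32) with hm3
  have w3 : MemLE (2 ^ W - 1) m3 := memLE_execOps_of_maxConst hW maxConst_opndX w2
  have hi3 : ∀ a, 40 ≤ a → m3 a = m a := fun a ha => by
    rw [cf a (not_mem_dests_of_le dests_opndX ha), hi2 a ha]
  have reg3 : ∀ a, a ≤ V → m3 (B + a) = cm a := fun a ha => by rw [hi3 _ (by omega), hreg a ha]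
  have X3 : m3 32 = X := by
    rw [cv, o21, o22, b8]
    exact read_decode_congr (hFV 4 (by omega)) hcm reg2
  -- operand Y
  have c8 : m3 8 = B := by rw [cf 8 (by decide), b8]
  have c24 : m3 24 = F 6 := by rw [cf 24 (by decide), o24]
  obtain ⟨dv, df⟩ := execOps_opnd (W := W) m3 (κr := 23) (vr := 24) (out := 33) (by omega) (by omega)
    (by omega) (hw w3) (by rw [c8]; omega)
    (by rw [c8, c24]; have := hFV 6 (by omega); omega)
    (by rw [c8, c24, reg3 _ (hFV 6 (by omega))]; have := hcm (F 6); omega)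
  set m4 := execOps W m3 (opnd 23 24 33) with hm4
  have w4 : MemLE (2 ^ W - 1) m4 := memLE_execOps_of_maxConst hW maxConst_opndY w3
  have hi4 : ∀ a, 40 ≤ a → m4 a = m a := fun a ha => by
    rw [df a (not_mem_dests_of_le dests_opndY ha), hi3 a ha]
  have reg4 : ∀ a, a ≤ V → m4 (B + a) = cm a := fun a ha => by rw [hi4 _ (by omega), hreg a ha]
  have Y4 : m4 33 = Y := by
    rw [dv, cf 23 (by decide), o23, c24, c8]
    exact read_decode_congr (hFV 6 (by omega)) hcm reg3
  have X4 : m4 32 = X := by rw [df 32 (by decide), X3]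
  have d8 : m4 8 = B := by rw [df 8 (by decide), c8]
  have d19 : m4 19 = F 1 := by rw [df 19 (by decide), cf 19 (by decide), o19]
  have d20 : m4 20 = F 2 := by rw [df 20 (by decide), cf 20 (by decide), o20]
  -- S5
  obtain ⟨e35, ef⟩ := execOps_S5_mask (show 2 ≤ W by omega) m4
  have e34 : F 1 ≠ 0 → (execOps W m4 S5) 34 = B + wa := fun hne => by
    rw [execOps_S5_target (show 2 ≤ W by omega) m4 (by rw [d8]; omega)
      (by rw [d8, d20]; have := hFV 2 (by omega); omega)
      (by rw [d8, d20, reg4 _ (hFV 2 (by omega))]; have := hcm (F 2); omega)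
      (by rw [d19]; exact hne), d8, d19, d20, reg4 _ (hFV 2 (by omega))]
  set m5 := execOps W m4 S5 with hm5
  have w5 : MemLE (2 ^ W - 1) m5 := memLE_execOps_of_maxConst hW maxConst_S5 w4
  have hi5 : ∀ a, 40 ≤ a → m5 a = m a := fun a ha => by
    rw [ef a (not_mem_dests_of_le dests_S5 ha), hi4 a ha]
  -- S6
  have e18 : m5 18 = F 0 := by rw [ef 18 (by decide), df 18 (by decide), cf 18 (by decide), o18]
  obtain ⟨g36, g37, g38, gf⟩ := execOps_S6 (show 2 ≤ W by omega) m5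
  set m6 := execOps W m5 S6 with hm6
  rw [e18] at g36 g37 g38
  have w6 : MemLE (2 ^ W - 1) m6 := memLE_execOps_of_maxConst hW maxConst_S6 w5
  have hi6 : ∀ a, 40 ≤ a → m6 a = m a := fun a ha => by
    rw [gf a (not_mem_dests_of_le dests_S6 ha), hi5 a ha]
  -- S7
  have s35 : m6 35 = (if F 1 = 0 then 0 else 1) := by rw [gf 35 (by decide), e35, d19]
  have s15 : m6 15 = 1 := by
    rw [gf 15 (by decide), ef 15 (by decide), df 15 (by decide), cf 15 (by decide), bf 15 (by omega),
      hgo]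
  obtain ⟨i35, i34, jf⟩ := execOps_S7 hW m6 (by rw [s35]; split_ifs <;> omega)
    (by rw [g36]; split_ifs <;> omega) (by omega) (hw w6 34)
  set m7 := execOps W m6 S7 with hm7
  have w7 : MemLE (2 ^ W - 1) m7 := memLE_execOps_of_maxConst hW maxConst_S7 w6
  have hi7 : ∀ a, 40 ≤ a → m7 a = m a := fun a ha => by
    rw [jf a (not_mem_dests_of_le dests_S7 ha), hi6 a ha]
  -- the write target
  have htgt : m7 34 = (if (0 < F 0 ∧ F 0 < 13) ∧ F 1 ≠ 0 then B + wa else 39) := by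
    rw [i34, s35, g36, s15]
    by_cases hop : 0 < F 0 ∧ F 0 < 13
    · by_cases hd : F 1 = 0
      · simp [hop, hd]
      · simp only [hop, hd, if_false, if_true, and_self, ne_eq, not_false_eq_true, Nat.mul_one]
        rw [gf 34 (by decide), e34 hd]
    · simp [hop]
  -- S8
  have k32 : m7 32 = X := by
    rw [jf 32 (by decide), gf 32 (by decide), ef 32 (by decide), X4]
  have k33 : m7 33 = Y := by
    rw [jf 33 (by decide), gf 33 (by decide), ef 33 (by decide), Y4]
  have k9 : m7 9 = 2 ^ w₀ := by
    rw [jf 9 (by decide), gf 9 (by decide), ef 9 (by decide), df 9 (by decide), cf 9 (by decide),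
      bf 9 (by omega), f1 9 (by decide), h9]
  have k18 : m7 18 = F 0 := by rw [jf 18 (by decide), gf 18 (by decide), e18]
  obtain ⟨kv, kf⟩ := execOps_S8 (show 1 ≤ W by omega) m7 (hw w7 32)
  set m8 := execOps W m7 S8 with hm8
  rw [k18, k32, k33, k9] at kv
  have w8 : MemLE (2 ^ W - 1) m8 := memLE_execOps_of_maxConst hW maxConst_S8 w7
  have hi8 : ∀ a, 40 ≤ a → m8 a = m a := fun a ha => by rw [kf a (by simp; omega), hi7 a ha]
  have u34 : m8 34 = (if (0 < F 0 ∧ F 0 < 13) ∧ F 1 ≠ 0 then B + wa else 39) := by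
    rw [kf 34 (by decide), htgt]
  -- S9
  have e9 := execOps_S9 (W := W) m8
  set m9 := execOps W m8 S9 with hm9
  have ntgt : ∀ a, a < 39 → a ≠ m8 34 := fun a ha => by
    rw [u34]; split_ifs <;> omega
  have nf : ∀ a, a < 39 → m9 a = m8 a := fun a ha => by rw [e9, Function.update_of_ne (ntgt a ha)]
  have w9 : MemLE (2 ^ W - 1) m9 := by
    rw [e9]; intro a; by_cases h : a = m8 34
    · rw [h, Function.update_self]; exact w8 _
    · rw [Function.update_of_ne h]; exact w8 _
  -- S10a
  have v36 : m9 36 = isOp := by rw [nf 36 (by omega), kf 36 (by decide), jf 36 (by decide), g36]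
  have v37 : m9 37 = isJmp := by rw [nf 37 (by omega), kf 37 (by decide), jf 37 (by decide), g37]
  have v38 : m9 38 = isJz := by rw [nf 38 (by omega), kf 38 (by decide), jf 38 (by decide), g38]
  have hisOp : isOp ≤ 1 := by simp only [isOp]; split_ifs <;> omega
  have hisJmp : isJmp ≤ 1 := by simp only [isJmp]; split_ifs <;> omega
  have hisJz : isJz ≤ 1 := by simp only [isJz]; split_ifs <;> omega
  have hex : isOp + isJmp + isJz ≤ 1 := by simp only [isOp, isJmp, isJz]; split_ifs <;> omega
  have x11 : m9 11 = p := by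
    rw [nf 11 (by omega), kf 11 (by decide), jf 11 (by decide), gf 11 (by decide), ef 11 (by decide),
      df 11 (by decide), cf 11 (by decide), bf 11 (by omega), p11]
  have x25 : m9 25 = F 7 := by
    rw [nf 25 (by omega), kf 25 (by decide), jf 25 (by decide), gf 25 (by decide), ef 25 (by decide),
      df 25 (by decide), cf 25 (by decide), o25]
  have x32 : m9 32 = X := by rw [nf 32 (by omega), kf 32 (by decide), k32]
  obtain ⟨l30, -, lf⟩ := execOps_S10a (show 2 ≤ W by omega) m9 (by rw [v36]; exact hisOp)
    (by rw [v37]; exact hisJmp) (by rw [v38]; exact hisJz) (by rw [v36, v37, v38]; exact hex)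
    (hw w9 25) (by rw [x11]; omega)
  set m10 := execOps W m9 S10a with hm10
  rw [v36, v37, v38, x32, x25, x11] at l30
  have w10 : MemLE (2 ^ W - 1) m10 := memLE_execOps_of_maxConst hW maxConst_S10a w9
  -- S10b
  have y15 : m10 15 = 1 := by
    rw [lf 15 (by decide), nf 15 (by omega), kf 15 (by decide), jf 15 (by decide), s15]
  have y12 : m10 12 = 0 := by
    rw [lf 12 (by decide), nf 12 (by omega), kf 12 (by decide), jf 12 (by decide), gf 12 (by decide),
      ef 12 (by decide), df 12 (by decide), cf 12 (by decide), bf 12 (by omega), hH1]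
  have y36 : m10 36 = isOp := by rw [lf 36 (by decide), v36]
  have y37 : m10 37 = isJmp := by rw [lf 37 (by decide), v37]
  have y38 : m10 38 = isJz := by rw [lf 38 (by decide), v38]
  have y11 : m10 11 = p := by rw [lf 11 (by decide), x11]
  obtain ⟨z12, z11, zf⟩ := execOps_S10b (show 2 ≤ W by omega) m10 (by rw [y36, y37, y38]; exact hex)
    (by rw [y15]) (by rw [y12, y15, y36, y37, y38]; omega) (hw w10 30) (hw w10 11)
  set m11 := execOps W m10 S10b with hm11
  rw [y12, y15, y36, y37, y38] at z12
  rw [y15, y36, y37, y38, l30, y11] at z11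
  have w11 : MemLE (2 ^ W - 1) m11 := memLE_execOps_of_maxConst hW maxConst_S10b w10
  have r10 : m11 10 = m 10 := by
    rw [zf 10 (by decide), lf 10 (by decide), nf 10 (by omega), kf 10 (by decide), jf 10 (by decide),
      gf 10 (by decide), ef 10 (by decide), df 10 (by decide), cf 10 (by decide), bf 10 (by omega),
      f1 10 (by decide)]
  -- S11
  have e11 : execOps W m11 S11 = Function.update m11 10 (m11 10 - 1) :=
    execOps_S11 m11 (by rw [r10]; exact h10) (hw w11 10)
  have hSTEP : execOps W m STEP = execOps W m11 S11 := by
    simp only [STEP, execOps_append, hm1, hm2, hm3, hm4, hm5, hm6, hm7, hm8, hm9, hm10, hm11]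
  rw [hSTEP, e11]
  -- cells ≥ 40 other than the target
  have hi : ∀ a, 40 ≤ a → a ≠ m8 34 → m11 a = m a := fun a ha hne => by
    rw [zf a (not_mem_dests_of_le dests_S10b ha), lf a (not_mem_dests_of_le dests_S10a ha), e9,
      Function.update_of_ne hne, hi8 a ha]
  refine ⟨?_, ?_, ?_, ?_, ?_, fun a ha hout => ?_, fun a ha => ?_, ?_⟩
  · rw [Function.update_of_ne (by decide), z12]; simp
  · rw [Function.update_of_ne (by decide), z11]; simp
  · rw [Function.update_self, r10]
  · rw [Function.update_of_ne (by decide), zf 8 (by decide), lf 8 (by decide), nf 8 (by omega),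
      kf 8 (by decide), jf 8 (by decide), gf 8 (by decide), ef 8 (by decide), d8, h8]
  · rw [Function.update_of_ne (by decide), zf 9 (by decide), lf 9 (by decide), nf 9 (by omega),
      kf 9 (by decide), k9, h9]
  · rw [Function.update_of_ne (by omega), hi a ha (by rw [u34]; split_ifs <;> omega)]
  · rw [Function.update_of_ne (by omega), zf _ (not_mem_dests_of_le dests_S10b (by omega)),
      lf _ (not_mem_dests_of_le dests_S10a (by omega)), e9, u34, kv]
    by_cases hwr : (0 < F 0 ∧ F 0 < 13) ∧ F 1 ≠ 0
    · rw [if_pos hwr, if_pos hwr, if_pos (by omega)]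
      rcases eq_or_ne a wa with rfl | hne
      · rw [Function.update_self, Function.update_self]
      · rw [Function.update_of_ne (by omega), Function.update_of_ne hne, hi8 _ (by omega), hreg a ha]
    · rw [if_neg hwr, if_neg hwr, Function.update_of_ne (by omega), hi8 _ (by omega), hreg a ha]
  · intro a; rcases eq_or_ne a 10 with rfl | h
    · rw [Function.update_self]; have := w11 10; omega
    · rw [Function.update_of_ne h]; exact w11 a

/-! ## The round simulates a clamped step of the stored program -/

/-- **The round is one clamped step.** Suppose the registers and the cells `B + a` (`a ≤ V`)
represent a configuration `c` of a program `Pd` whose `|Pd|` instructions are the decodings of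
the code words in cells `44 …` (all `≤ V`), at the simulated word size `w₀` (`P₀ = 2 ^ w₀` in
register `9`), with `H = [c halted]`, `PC = ` the program counter, and `c`'s memory `V`-bounded.
Then after `STEP` the registers and cells represent `stepTotal Pd w₀ noOracle zeroCoins c` in the
same sense, the fuel is decremented, and the code, the constants and all other cells `≥ 40` are
unchanged. [folklore] -/
theorem round_spec {W B V w₀ nP : ℕ} (hW : 6 ≤ W) {m : ℕ → ℕ} (hm : MemLE (2 ^ W - 1) m)
    (h8 : m 8 = B) (h9 : m 9 = 2 ^ w₀) (h42 : m 42 = nP) (hnP : nP ≤ V) (h10 : 1 ≤ m 10)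
    (hB : 44 + 8 * V + 8 ≤ B) (hBV : B + V < 2 ^ W) (hVw : V + 2 ^ w₀ < 2 ^ W) (hw₀ : w₀ ≤ W)
    {Pd : Program} (hlen : Pd.length = nP)
    (hcode : ∀ i, i < nP → Pd[i]? = some (Instr.decode (m (44 + 8 * i)) (m (44 + 8 * i + 1))
      (m (44 + 8 * i + 2)) (m (44 + 8 * i + 3)) (m (44 + 8 * i + 4)) (m (44 + 8 * i + 5))
      (m (44 + 8 * i + 6)) (m (44 + 8 * i + 7))))
    (hcodeV : ∀ i f, i < nP → f < 8 → m (44 + 8 * i + f) ≤ V)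
    {c : Cfg} (hH : m 12 = if c.pc = none then 1 else 0) (hPC : ∀ p, c.pc = some p → m 11 = p)
    (h11 : m 11 ≤ V) (hreg : ∀ a, a ≤ V → m (B + a) = c.mem a) (hcm : MemLE V c.mem) :
    ((execOps W m STEP) 12 = if (stepTotal Pd w₀ noOracle zeroCoins c).pc = none then 1 else 0) ∧
    (∀ p, (stepTotal Pd w₀ noOracle zeroCoins c).pc = some p → (execOps W m STEP) 11 = p) ∧
    (execOps W m STEP) 11 ≤ V ∧
    (∀ a, a ≤ V → (execOps W m STEP) (B + a) = (stepTotal Pd w₀ noOracle zeroCoins c).mem a) ∧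
    (execOps W m STEP) 10 = m 10 - 1 ∧ (execOps W m STEP) 8 = m 8 ∧ (execOps W m STEP) 9 = m 9 ∧
    (∀ a, 40 ≤ a → (a < B ∨ B + V < a) → (execOps W m STEP) a = m a) ∧
    MemLE (2 ^ W - 1) (execOps W m STEP) := by
  have hgeom : 8 * V + 52 ≤ 2 ^ W := by omega
  cases hpc : c.pc with
  | none =>
    -- halted: a passive round, and the clamped step stays put
    rw [hpc] at hH; simp only [if_true] at hH
    have hst : stepTotal Pd w₀ noOracle zeroCoins c = c :=
      stepTotal_of_step_eq_none _ _ _ _ (step_of_pc_eq_none hpc)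
    obtain ⟨r12, r11, r10, r8, r9, rhi, rw⟩ :=
      round_passive (V := V) hW hm h11 (by omega) (Or.inl hH) hgeom h10
    rw [hst, hpc]
    exact ⟨by rw [r12]; simp, fun p h => by simp at h, by rw [r11]; exact h11,
      fun a ha => by rw [rhi _ (by omega), hreg a ha], r10, r8, r9,
      fun a ha _ => rhi a ha, rw⟩
  | some p =>
    rw [hpc] at hH; simp only [reduceCtorEq, if_false] at hH
    have hp11 : m 11 = p := hPC p hpc
    by_cases hpn : p < nP
    · -- active round
      have hI := hcode p hpn
      obtain ⟨r12, r11, r10, r8, r9, rhi, rreg, rw⟩ := round_active (F := fun f => m (44 + 8 * p + f))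
        hW hm h8 h9 hp11 hH h42 hpn hnP h10 hB hBV hVw (fun f _ => rfl)
        (fun f hf => hcodeV p f hpn hf) hreg hcm
      simp only [Nat.add_zero] at r12 r11 rreg
      -- abbreviations
      set X := (Operand.decode (m (44 + 8 * p + 3)) (m (44 + 8 * p + 4))).read c.mem with hX
      set Y := (Operand.decode (m (44 + 8 * p + 5)) (m (44 + 8 * p + 6))).read c.mem with hY
      have hXV : X ≤ V :=
        Operand.read_le hcm _ (by rw [Operand.const_decode]; exact hcodeV p 4 hpn (by omega))
      have ht : m (44 + 8 * p + 7) ≤ V := hcodeV p 7 hpn (by omega)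
      unfold Instr.decode at hI
      by_cases hz : m (44 + 8 * p) = 0
      · -- halt
        rw [if_pos hz] at hI
        have hst : stepTotal Pd w₀ noOracle zeroCoins c = { c with pc := none } :=
          stepTotal_of_step _ _ _ _ (step_halt hpc hI)
        rw [hst]
        refine ⟨by rw [r12]; simp [hz], fun q hq => by simp at hq, by rw [r11]; simp [hz]; omega,
          fun a ha => by rw [rreg a ha]; simp [hz], r10, r8, r9, rhi, rw⟩
      rw [if_neg hz] at hI
      by_cases hop : m (44 + 8 * p) ≤ 12
      · -- operation
        rw [if_pos hop] at hI
        have hst := stepTotal_of_step _ _ _ _ (step_op (w := w₀) (O := noOracle) (ρ := zeroCoins) hpc hI)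
        have hop' : 0 < m (44 + 8 * p) ∧ m (44 + 8 * p) < 13 := by omega
        have h13 : m (44 + 8 * p) ≠ 13 := by omega
        have h14 : m (44 + 8 * p) ≠ 14 := by omega
        rw [hst]
        refine ⟨by rw [r12]; simp [hop', h13, h14], fun q hq => ?_, by rw [r11]; simp [hop', h13, h14, newPC]; omega,
          fun a ha => ?_, r10, r8, r9, rhi, rw⟩
        · simp only [Option.some.injEq] at hq; rw [r11]; simp [hop', h13, h14, newPC, hq]
        · rw [rreg a ha]; simp only [hop', true_and]
          rw [← hX, ← hY, aluRaw_eq_eval hop'.1 hop hw₀ (by omega), Operand.write_decode]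
          by_cases hd0 : m (44 + 8 * p + 1) = 0
          · simp [hd0]
          · rw [if_pos hd0, if_neg hd0]
            by_cases hd1 : m (44 + 8 * p + 1) = 1
            · simp [hd1]
            · rw [if_neg hd1, if_neg hd1]
      rw [if_neg hop] at hI
      by_cases h13 : m (44 + 8 * p) = 13
      · -- jump
        rw [if_pos h13] at hI
        have hst := stepTotal_of_step _ _ _ _ (step_jmp (w := w₀) (O := noOracle) (ρ := zeroCoins) hpc hI)
        have hop' : ¬ (0 < m (44 + 8 * p) ∧ m (44 + 8 * p) < 13) := by omega
        rw [hst]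
        refine ⟨by rw [r12]; simp [h13], fun q hq => ?_, by rw [r11]; simp [h13, newPC]; omega,
          fun a ha => by rw [rreg a ha]; simp [hop'], r10, r8, r9, rhi, rw⟩
        simp only [Option.some.injEq] at hq; rw [r11]; simp [h13, newPC, hq]
      rw [if_neg h13] at hI
      by_cases h14 : m (44 + 8 * p) = 14
      · -- conditional jump
        rw [if_pos h14] at hI
        have hst := stepTotal_of_step _ _ _ _ (step_jz (w := w₀) (O := noOracle) (ρ := zeroCoins) hpc hI)
        have hop' : ¬ (0 < m (44 + 8 * p) ∧ m (44 + 8 * p) < 13) := by omega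
        rw [hst]
        have e11 : execOps W m STEP 11 = if X = 0 then m (44 + 8 * p + 7) else p + 1 := by
          rw [r11]; simp [h14, newPC]
        refine ⟨?_, fun q hq => ?_, ?_, fun a ha => by rw [rreg a ha]; simp [hop'], r10, r8, r9, rhi, rw⟩
        · have lhs : execOps W m STEP 12 = 0 := by rw [r12]; simp [h14]
          rw [lhs, eq_comm, if_neg]
          · split_ifs <;> simp
        · rw [e11]
          simp only [← hX] at hq
          by_cases hx0 : X = 0
          · rw [if_pos hx0] at hq ⊢; simpa using hq
          · rw [if_neg hx0] at hq ⊢; simpa using hq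
        · rw [e11]; split_ifs <;> omega
      · -- unknown opcode: halt
        rw [if_neg h14] at hI
        have hst : stepTotal Pd w₀ noOracle zeroCoins c = { c with pc := none } :=
          stepTotal_of_step _ _ _ _ (step_halt hpc hI)
        have hop' : ¬ (0 < m (44 + 8 * p) ∧ m (44 + 8 * p) < 13) := by omega
        rw [hst]
        refine ⟨by rw [r12]; simp [hop', h13, h14], fun q hq => by simp at hq, by rw [r11]; simp [hop', h13, h14]; omega,
          fun a ha => by rw [rreg a ha]; simp [hop'], r10, r8, r9, rhi, rw⟩
    · -- program counter out of range: a passive round, the machine halts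
      have hnone : Pd[p]? = none := List.getElem?_eq_none (by omega)
      have hst : stepTotal Pd w₀ noOracle zeroCoins c = { c with pc := none } :=
        stepTotal_of_step _ _ _ _ (step_of_getElem?_eq_none hpc hnone)
      obtain ⟨r12, r11, r10, r8, r9, rhi, rw⟩ :=
        round_passive (V := V) hW hm h11 (by omega) (Or.inr (by rw [h42, hp11]; omega)) hgeom h10
      rw [hst]
      exact ⟨by rw [r12]; simp, fun q hq => by simp at hq, by rw [r11]; exact h11,
        fun a ha => by rw [rhi _ (by omega), hreg a ha], r10, r8, r9, fun a ha _ => rhi a ha, rw⟩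

end Univ

end Literature.Computability.Cryptography.WordRAM
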